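import Mathlib
import Summits.Ventures.PercRepro2.CrossAPrimeA2VEdge

/-!
# The degenerate placements of the marks: `o = v`, `b = v`, `o = b`
(blind cell PercRepro2, p5 g36; S4 §2.4 (s) addenda 35 (1) «o = v remains paper», 41)

With `o = v` the route masses `xv = P(Q, a₁ ↔ v, v ∈ K)` and `Dv` vanish (`v ∈ K` and `a₁ ↔ v`
would put `a₁` into `K`), so `crossC(c) = x·(c·y − yv)`, and `yv ≤ c·y` for the admissible
constant `c = P(a₁ ↔ v in G ∖ {a₂})` (`CrossAPrimeA2VEdge.prob_Q_vL_le_mul`,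
`CrossAPrimeA2Induction.adm_del_a2`): **`crossA'so_nonneg_of_o_eq_v`**, and symmetrically
**`crossA'so_nonneg_of_b_eq_v`**.  With `o = b`, `crossC(c) = 2·xv·(Z − x) + c·x²` is a sum
of nonnegative terms: **`crossA'so_nonneg_of_o_eq_b`**.  These are the placements the two-route
and the free-part theorems leave aside; they hold for EVERY graph.  Own work; standard axioms.
-/

namespace Summit.Ventures.PercRepro2

open LeafRowPendantRootSO CrossAPrimeA2Route CrossAPrimeA2Induction CrossAPrimeA2VEdge

namespace CrossAPrimeMarkAtV

variable {V : Type*} {E : Type*} [Fintype E] [DecidableEq E] [Fintype V] [DecidableEq V]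
  {R : Type*} [Field R] [LinearOrder R] [IsStrictOrderedRing R]
variable {ends : E → Sym2 V}

omit [Fintype E] [DecidableEq E] [Fintype V] [DecidableEq V] [LinearOrder R]
  [IsStrictOrderedRing R] in
/-- `Q ∩ {a₁ ↔ v} ∩ {v ∈ K} ∩ A` is empty. -/
lemma Q_L_vH_eq_empty (a₁ a₂ v : V) (A : Set (Config E)) :
    avoidAll ends a₂ {a₁} ∩ (connEvent ends a₁ v ∩ (connEvent ends a₂ v ∩ A)) = ∅ := by
  ext ω
  simp only [Set.mem_inter_iff, Set.mem_empty_iff_false, iff_false, not_and]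
  intro hQ hL hv _
  exact hQ a₁ (Finset.mem_singleton_self a₁) (conn_trans hv (conn_symm hL))

omit [Fintype V] [DecidableEq V] [LinearOrder R] [IsStrictOrderedRing R] in
/-- The route mass of `v` itself vanishes, with or without a second membership. -/
lemma prob_Q_L_vH_eq_zero (p : E → R) (a₁ a₂ v : V) :
    prob p (avoidAll ends a₂ {a₁} ∩ (connEvent ends a₁ v ∩ connEvent ends a₂ v)) = 0 ∧
      ∀ b, prob p (avoidAll ends a₂ {a₁} ∩
        (connEvent ends a₁ v ∩ (connEvent ends a₂ v ∩ connEvent ends a₂ b))) = 0 := by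
  refine ⟨?_, fun b => ?_⟩
  · have := Q_L_vH_eq_empty (ends := ends) a₁ a₂ v Set.univ
    rw [Set.inter_univ] at this
    rw [this, prob_empty]
  · rw [Q_L_vH_eq_empty, prob_empty]

omit [DecidableEq V] in
/-- `yv ≤ c·y` for an admissible `c`. -/
lemma prob_Q_L_le (p : E → R) (hp : IsProbVec p) {c : R} {a₁ a₂ v : V}
    (hadm : Adm p c ends a₁ a₂ v) (b : V) :
    prob p (avoidAll ends a₂ {a₁} ∩ (connEvent ends a₁ v ∩ connEvent ends a₂ b)) ≤
      c * prob p (avoidAll ends a₂ {a₁} ∩ connEvent ends a₂ b) := by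
  have key := prob_Q_vL_le_mul hp hadm {A : Set V | b ∈ A}
  rw [← connEvent_eq_clusterInEvent' a₂ b] at key
  have e1 : connEvent ends a₂ b ∩ connEvent ends a₁ v ∩ avoidAll ends a₂ {a₁} =
      avoidAll ends a₂ {a₁} ∩ (connEvent ends a₁ v ∩ connEvent ends a₂ b) := by
    ext ω; simp only [Set.mem_inter_iff]; tauto
  have e2 : connEvent ends a₂ b ∩ avoidAll ends a₂ {a₁} =
      avoidAll ends a₂ {a₁} ∩ connEvent ends a₂ b := Set.inter_comm _ _
  rw [e1, e2] at key
  exact key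

omit [DecidableEq V] in
/-- **The placement `o = v`**: `0 ≤ crossA′so` for every graph. -/
theorem crossA'so_nonneg_of_o_eq_v (p : E → R) (hp : IsProbVec p) (a₁ a₂ v b : V) :
    0 ≤ crossA'so p ends v a₁ a₂ v b := by
  refine crossA'so_nonneg_of_crossC hp v a₁ a₂ v b (prob_del_a2_le hp a₁ a₂ v) ?_
  obtain ⟨h0, hD⟩ := prob_Q_L_vH_eq_zero (ends := ends) p a₁ a₂ v
  have hyv := prob_Q_L_le (ends := ends) p hp (adm_del_a2 hp a₁ a₂ v) b
  have hx : 0 ≤ prob p (avoidAll ends a₂ {a₁} ∩ connEvent ends a₂ v) := prob_nonneg hp _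
  unfold crossC
  rw [hD b, h0]
  nlinarith [mul_le_mul_of_nonneg_left hyv hx]

omit [Fintype E] [DecidableEq E] [Fintype V] [DecidableEq V] [LinearOrder R]
  [IsStrictOrderedRing R] in
/-- Swapping the two memberships in the double-membership route mass. -/
lemma Q_L_swap (a₁ a₂ v o b : V) :
    avoidAll ends a₂ {a₁} ∩ (connEvent ends a₁ v ∩ (connEvent ends a₂ o ∩ connEvent ends a₂ b)) =
      avoidAll ends a₂ {a₁} ∩ (connEvent ends a₁ v ∩ (connEvent ends a₂ b ∩ connEvent ends a₂ o)) := by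
  rw [Set.inter_comm (connEvent ends a₂ o)]

omit [DecidableEq V] in
/-- **The placement `b = v`**: `0 ≤ crossA′so` for every graph. -/
theorem crossA'so_nonneg_of_b_eq_v (p : E → R) (hp : IsProbVec p) (o a₁ a₂ v : V) :
    0 ≤ crossA'so p ends o a₁ a₂ v v := by
  refine crossA'so_nonneg_of_crossC hp o a₁ a₂ v v (prob_del_a2_le hp a₁ a₂ v) ?_
  obtain ⟨h0, hD⟩ := prob_Q_L_vH_eq_zero (ends := ends) p a₁ a₂ v
  have hxv := prob_Q_L_le (ends := ends) p hp (adm_del_a2 hp a₁ a₂ v) o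
  have hy : 0 ≤ prob p (avoidAll ends a₂ {a₁} ∩ connEvent ends a₂ v) := prob_nonneg hp _
  unfold crossC
  rw [Q_L_swap, hD o, h0]
  nlinarith [mul_le_mul_of_nonneg_left hxv hy]

omit [Fintype V] [DecidableEq V] in
/-- **The placement `o = b`**: `crossC(c) = 2·xv·(Z − x) + c·x² ≥ 0` for every `c ≥ 0`. -/
theorem crossA'so_nonneg_of_o_eq_b (p : E → R) (hp : IsProbVec p) (o a₁ a₂ v : V) :
    0 ≤ crossA'so p ends o a₁ a₂ v o := by
  rw [crossA'so_eq_crossC]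
  unfold crossC
  have e : connEvent ends a₂ o ∩ connEvent ends a₂ o = connEvent ends a₂ o := Set.inter_self _
  rw [e]
  have hZx : prob p (avoidAll ends a₂ {a₁} ∩ connEvent ends a₂ o) ≤ prob p (avoidAll ends a₂ {a₁}) :=
    prob_mono hp Set.inter_subset_left
  have hxv0 : 0 ≤ prob p (avoidAll ends a₂ {a₁} ∩ (connEvent ends a₁ v ∩ connEvent ends a₂ o)) :=
    prob_nonneg hp _
  have hx0 : 0 ≤ prob p (avoidAll ends a₂ {a₁} ∩ connEvent ends a₂ o) := prob_nonneg hp _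
  have hπ : 0 ≤ prob p (connEvent ends a₁ v) := prob_nonneg hp _
  nlinarith [mul_nonneg hxv0 (sub_nonneg.2 hZx), mul_nonneg hπ (mul_nonneg hx0 hx0)]

end CrossAPrimeMarkAtV

end Summit.Ventures.PercRepro2
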